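import Literature.AnabelianGeometry.AbsoluteAnabelian.AbsTopII.TwoTripodNodalIndexLogPoints
import Literature.AnabelianGeometry.AbsoluteAnabelian.AbsTopII.TwoTripodNodalProp13x
import HarnessLib

/-!
# [AbsTopII] Prop 1.3 (x) at the index-`i` two-vertex datum, III: the engines — no section is conjugate to a foreign one

S. Mochizuki, *Topics in Absolute Anabelian Geometry II* [AbsTopII] (bib `MochizukiAbsTopII2013`; locators =
PDF pages of the kurims manuscript `paper:url-585b8d0ad0d9`), §1 Prop 1.3 (x) p. 12 ("`τ_I` satisfies the condition
`τ_I(I) = I_{v_τ}` […] if and only if the image of `τ_S` is a non-nodal point of the irreducible component […]; `τ_I` is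
non-verticial and satisfies the condition `τ_I(I) ⊆ I_{e_τ}` for some node `e_τ` […] if and only if the image of `τ_S`
is the node") and Prop 1.3 (iv) p. 11 ("`I_v ∩ I_{v′} ≠ {1}` implies that `v = v′`").

PROOF-ONLY companion (abc-iut-f-066 gen 8, row «TWO-VERTEX-Σ-INDEX-i») of `AbsTopII/TwoTripodNodalIndexLogPoints.lean`,
the ENGINES behind Prop 1.3 (x) at the index-`i` datum `M.dpscIdx` (closers in `TwoTripodNodalIndexProp13x.lean`):

* `not_conj_le_conj_of_le_cuspD` — abc-iut-f-066 gen 7's slope-section engine for an ARBITRARY section `S ⊆ D_{c_j}`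
  not contained in `I_v(dpsc)`: no `P`-conjugate of `S` lies in a `Π_𝔾`-conjugate of `D_e` / `D_{c_{j'}}` (`j' ≠ j`);
  instances for the index-`i` slope sections `closure ⟨ι(c_j)^n s_j^i⟩`, `n ≥ 1`;
* `commutator_mem_PiG` — `P/Π_𝔾 ≅ Ẑ^Σ` is abelian (retraction `P ↠ T`); hence `conj_smul_ne_of_character`: **two
  sections `closure ⟨x⟩`, `S' ∋ x'` with `x ≡ x' (mod Π_𝔾)` are NOT conjugate in `P` as soon as an abelian character
  `χ : P → T` separates `x` from `x'`** (a conjugate of `x` inside the section `S'` must BE `x'`);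
* ★ `not_conj_nodeSection_eq_Tpow/Upow` — with abc-iut-f-066 gen 6's `T`-side character (`χ(w) = t₀`, `χ|_T = id`,
  `χ|_U = 1`): **the node section `closure ⟨w^{-m} t₀^i⟩` (`0 < m < i`) is no `P`-conjugate of `I_{v_A} = closure ⟨t₀^i⟩`
  (`χ`-values `t₀^{i-m}` vs `t₀^i`) nor of `I_{v_B} = closure ⟨u₀^i⟩` (`t₀^{i-m}` vs `1`)**;
* `eq_of_le_of_isCompl_PiG` — a section contained in another section of the same `Π_I^{(i)} ↠ I` equals it; whence
  ★ `not_conj_nodeSection_le_conj_vertSecIdx` (the node members are NON-VERTICIAL);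
* `Tpow_ne_conj_Upow` — `I_{v_A}`, `I_{v_B}` are not conjugate (`T ∩ gUg⁻¹ = 1`, gen 5; `t₀^i ≠ 1`).
HONEST FRAMING: classical profinite group theory at a constructed model (constructed ≠ geometric); nothing here bears on
[IUTchIII] Cor 3.12; no side taken.
-/

noncomputable section

open scoped Pointwise

namespace Literature.AnabelianGeometry.AbsoluteAnabelian.AbsTopII.TwoTripodNodal.Model

open Literature.AnabelianGeometry.SemiGraphs
open Literature.AnabelianGeometry.SemiGraphs.SemiGraphOfAnabelioids (IsProSigmaCompletion)
open Literature.AnabelianGeometry.SemiGraphs.SemiGraphOfAnabelioids.IsProSigmaCompletion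
open Literature.AnabelianGeometry.Anabelioids (IsSigmaInteger)
open Literature.GroupTheory.CombinatorialGroupTheory
open Literature.GroupTheory.CombinatorialGroupTheory.PuncturedSurfaceGroup
open _root_.Topology

variable {Sigma : Set ℕ} (M : Model Sigma) (i : ℕ)

/-! ### Non-triviality: `t₀ ≠ 1`, `closure ⟨t₀^i⟩ ≠ 1`, `closure ⟨u₀^i⟩ ≠ 1` -/

/-- `t₀ ≠ 1` (`T = closure ⟨t₀⟩ ≠ 1`). [cite: MochizukiAbsTopII2013, Prop 1.3 (iii) p.11] -/
theorem t0_ne_one (hne : Sigma.Nonempty) (hprime : ∀ p ∈ Sigma, p.Prime) :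
    M.ι (SemidirectProduct.inr (Multiplicative.ofAdd (1 : ℤ))) ≠ 1 := fun h =>
  M.T_ne_bot hne hprime (by
    have hc : IsClosed ((⊥ : Subgroup M.P) : Set M.P) := by rw [Subgroup.coe_bot]; exact isClosed_singleton
    rw [T_eq_closure_zpowers_t0, h, Subgroup.zpowers_one_eq_bot]
    exact (Subgroup.topologicalClosure_minimal _ le_rfl hc).antisymm bot_le)

/-- `t₀^i ≠ 1` for `i ≥ 1`. [cite: MochizukiAbsTopII2013, Prop 1.3 (iii) p.11] -/
theorem t0_pow_ne_one (hne : Sigma.Nonempty) (hprime : ∀ p ∈ Sigma, p.Prime) {n : ℕ} (hn : 0 < n) :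
    M.ι (SemidirectProduct.inr (Multiplicative.ofAdd (1 : ℤ))) ^ n ≠ 1 :=
  M.pow_ne_one_of_mem_T M.t0_mem_T (M.t0_ne_one hne hprime) hn

/-- `closure ⟨t₀^i⟩ ≠ 1` for `i ≥ 1`. [cite: MochizukiAbsTopII2013, Prop 1.3 (iii) p.11] -/
theorem Tpow_ne_bot (hne : Sigma.Nonempty) (hprime : ∀ p ∈ Sigma, p.Prime) (hi0 : 0 < i) : M.Tpow i ≠ ⊥ := fun h =>
  M.t0_pow_ne_one hne hprime hi0 (by rw [← Subgroup.mem_bot, ← h]; exact M.t0_pow_mem_Tpow i)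

/-- `u₀ ≠ 1` (`U ≠ 1` since `U · Π_𝔾 = P ≠ Π_𝔾`). [cite: MochizukiAbsTopII2013, Prop 1.3 (iii) p.11] -/
theorem u0_ne_one (hne : Sigma.Nonempty) (hprime : ∀ p ∈ Sigma, p.Prime) :
    M.ι (SemidirectProduct.inl (c 1 * c 2 : PuncturedSurfaceGroup 0 4)⁻¹ *
      SemidirectProduct.inr (Multiplicative.ofAdd (1 : ℤ))) ≠ 1 := by
  intro h
  apply M.PiG_ne_top hne hprime
  have hc : IsClosed ((⊥ : Subgroup M.P) : Set M.P) := by rw [Subgroup.coe_bot]; exact isClosed_singleton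
  have hU : M.U = ⊥ := by
    rw [Model.U, h, Subgroup.zpowers_one_eq_bot]
    exact (Subgroup.topologicalClosure_minimal _ le_rfl hc).antisymm bot_le
  have h2 := M.U_sup_PiG
  rwa [hU, bot_sup_eq] at h2

/-- `closure ⟨u₀^i⟩ ≠ 1` for `i ≥ 1`. [cite: MochizukiAbsTopII2013, Prop 1.3 (iii) p.11] -/
theorem Upow_ne_bot (hne : Sigma.Nonempty) (hprime : ∀ p ∈ Sigma, p.Prime) (hi0 : 0 < i) : M.Upow i ≠ ⊥ := fun h =>
  M.pow_ne_one_of_mem_U hne hprime M.u0_mem_U (M.u0_ne_one hne hprime) hi0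
    (by rw [← Subgroup.mem_bot, ← h]; exact M.u0_pow_mem_Upow i)

/-! ### The slope-section engine for an arbitrary section inside `D_{c_j}` -/

/-- **Engine (abc-iut-f-066 gen 7, generalised).**  Let `S ⊆ Π_{c_j}·I_v(dpsc) = D_{c_j}` be a subgroup NOT contained in
`I_v(dpsc)`, and `D ⊆ P` with `(Π_{c_j}·I_v) ∩ γ D γ⁻¹ ⊆ I_v` for all `γ ∈ Π_𝔾`.  Then no conjugate `δ S δ⁻¹` (`δ ∈ P`)
lies in a `Π_𝔾`-conjugate of `D` (write `δ = γ₁ s`, `s ∈ I_v`; a containment gives `s S s⁻¹ ⊆ I_v`).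
[cite: MochizukiAbsTopII2013, Prop 1.3 (x) p.12] -/
theorem not_conj_le_conj_of_le_cuspD (j : Fin 4) {S : Subgroup M.P}
    (hS : S ≤ (M.cuspGp j).map M.PiG.subtype ⊔ M.baseSec j) (hSb : ¬ S ≤ M.baseSec j) (δ : M.P) {D : Subgroup M.P}
    (hD : ∀ γ ∈ M.PiG, ((M.cuspGp j).map M.PiG.subtype ⊔ M.baseSec j) ⊓ MulAut.conj γ • D ≤ M.baseSec j)
    {γ : M.P} (hγ : γ ∈ M.PiG) : ¬ MulAut.conj δ • S ≤ MulAut.conj γ • D := by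
  intro h
  obtain ⟨γ₁, hγ₁, s, hs, rfl⟩ := M.exists_eq_mul_of_sup_eq_top (M.baseSec_sup_PiG j) δ
  have h1 : MulAut.conj s • S ≤ MulAut.conj (γ₁⁻¹ * γ) • D := by
    rw [map_mul, mul_smul, Subgroup.pointwise_smul_subset_iff, ← mul_smul, ← map_inv, ← map_mul] at h
    exact h
  have h2 : MulAut.conj s • S ≤ (M.cuspGp j).map M.PiG.subtype ⊔ M.baseSec j := by
    have h' := Subgroup.pointwise_smul_le_pointwise_smul_iff (a := MulAut.conj s).mpr hS
    rwa [Subgroup.conj_smul_eq_self_of_mem (Subgroup.mem_sup_right hs)] at h'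
  have h3 : MulAut.conj s • S ≤ M.baseSec j := le_trans (le_inf h2 h1) (hD _ (M.PiG.mul_mem (M.PiG.inv_mem hγ₁) hγ))
  have h4 : S ≤ M.baseSec j := by
    rw [Subgroup.pointwise_smul_subset_iff, ← map_inv, Subgroup.conj_smul_eq_self_of_mem (Subgroup.inv_mem _ hs)] at h3
    exact h3
  exact hSb h4

/-- **A slope section of positive slope at index `i` is not contained in `I_v(dpsc)`** (`ι(c_j)^n s_j^i ∈ I_v` would put
`ι(c_j)^n` in `I_v`). [cite: MochizukiAbsTopII2013, Prop 1.3 (x) p.12] -/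
theorem not_cuspSectionIdx_le_baseSec (hne : Sigma.Nonempty) (hprime : ∀ p ∈ Sigma, p.Prime) (j : Fin 4) {n : ℕ}
    (hn : 0 < n) : ¬ M.cuspSectionIdx i j n ≤ M.baseSec j := fun h =>
  M.inl_pow_notMem_baseSec hne hprime j hn ((Subgroup.mul_mem_cancel_right _
    (Subgroup.pow_mem _ (M.baseGen_mem_baseSec j) i)).mp (h (M.cuspGenIdx_mem i j n)))

/-- **No conjugate of the index-`i` slope section (`n ≥ 1`) lies in a `Π_𝔾`-conjugate of `D_e = Π_e·T`.**
[cite: MochizukiAbsTopII2013, Prop 1.3 (x) p.12] -/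
theorem not_conj_cuspSectionIdx_le_conj_nodeD (hne : Sigma.Nonempty) (hprime : ∀ p ∈ Sigma, p.Prime) (j : Fin 4)
    {n : ℕ} (hn : 0 < n) (δ : M.P) {γ : M.P} (hγ : γ ∈ M.PiG) :
    ¬ MulAut.conj δ • M.cuspSectionIdx i j n ≤ MulAut.conj γ • ((M.nodeGp).map M.PiG.subtype ⊔ M.T) :=
  M.not_conj_le_conj_of_le_cuspD j (M.cuspSectionIdx_le_cuspD i hne hprime j n)
    (M.not_cuspSectionIdx_le_baseSec i hne hprime j hn) δ (fun _ hγ' => M.cuspD_inf_conj_nodeD_le_baseSec hne hprime j hγ') hγ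

/-- **No conjugate of the index-`i` slope section (`n ≥ 1`) lies in a `Π_𝔾`-conjugate of `D_{c_{j'}}`, `j' ≠ j`.**
[cite: MochizukiAbsTopII2013, Prop 1.3 (x) p.12] -/
theorem not_conj_cuspSectionIdx_le_conj_cuspD (hne : Sigma.Nonempty) (hprime : ∀ p ∈ Sigma, p.Prime) (j : Fin 4)
    {n : ℕ} (hn : 0 < n) (δ : M.P) {j' : Fin 4} (hjj' : j' ≠ j) {γ : M.P} (hγ : γ ∈ M.PiG) :
    ¬ MulAut.conj δ • M.cuspSectionIdx i j n ≤ MulAut.conj γ • ((M.cuspGp j').map M.PiG.subtype ⊔ M.baseSec j') :=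
  M.not_conj_le_conj_of_le_cuspD j (M.cuspSectionIdx_le_cuspD i hne hprime j n)
    (M.not_cuspSectionIdx_le_baseSec i hne hprime j hn) δ
    (fun _ hγ' => M.cuspD_inf_conj_cuspD_le_baseSec hne hprime j j' hjj' hγ') hγ

/-! ### `P/Π_𝔾` is abelian; sections separated by an abelian character are not conjugate -/

/-- **`[P, P] ⊆ Π_𝔾`**: `g x g⁻¹ x⁻¹ ∈ Π_𝔾` for all `g, x ∈ P` (the retraction `P ↠ T ≅ Ẑ^Σ` has kernel `Π_𝔾` and
abelian target). [cite: MochizukiAbsTopII2013, Def 1.2 (ii) p.10] -/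
theorem commutator_mem_PiG (g x : M.P) : g * x * g⁻¹ * x⁻¹ ∈ M.PiG := by
  obtain ⟨F, -, -, hFT, hFA⟩ : ∃ F : M.P →* ↥M.T, Continuous F ∧
      (∀ x, (F (M.ι x) : M.P) = M.ι (SemidirectProduct.inr (SemidirectProduct.rightHom x))) ∧
      (∀ (t : M.P) (_ : t ∈ M.T), (F t : M.P) = t) ∧ ∀ a ∈ M.PiG, F a = 1 :=
    SemidirectCofinal.exists_retraction M.φ M.isProSigmaCompletion
  have hcomm : F g * F x = F x * F g :=
    Subtype.ext (M.isFreeProSigmaCyclic_T.subgroup_comm _ (F g).2 _ (F x).2)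
  have h1 : F (g * x * g⁻¹ * x⁻¹) = 1 := by
    rw [map_mul, map_mul, map_mul, map_inv, map_inv, hcomm, mul_assoc (F x), mul_inv_cancel, mul_one, mul_inv_cancel]
  exact (SemidirectCofinal.retraction_eq_one_iff M.φ M.isProSigmaCompletion hFT hFA _).mp h1

/-- **Sections separated by an abelian character are not conjugate.**  Let `χ : P → T` be a homomorphism into the
abelian `T`, `S = closure ⟨x⟩`, `S'` a section meeting `Π_𝔾` trivially with `x' ∈ S'` and `x ≡ x' (mod Π_𝔾)`.  If
`g S g⁻¹ = S'` then `g x g⁻¹ ∈ S'` is congruent to `x'` modulo `Π_𝔾` (`P/Π_𝔾` abelian), hence EQUAL to `x'`, and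
`χ(x) = χ(g x g⁻¹) = χ(x')`.  So `χ(x) ≠ χ(x')` forbids conjugacy. [cite: MochizukiAbsTopII2013, Prop 1.3 (x) p.12] -/
theorem conj_smul_ne_of_character (χ : M.P →* ↥M.T) {x x' : M.P} {S' : Subgroup M.P} (hx' : x' ∈ S')
    (hS' : S' ⊓ M.PiG = ⊥) (hxx' : x * x'⁻¹ ∈ M.PiG) (hχ : χ x ≠ χ x') (g : M.P) :
    MulAut.conj g • (Subgroup.zpowers x).topologicalClosure ≠ S' := by
  intro h
  have hgx : g * x * g⁻¹ ∈ S' := by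
    rw [← h]
    exact Subgroup.smul_mem_pointwise_smul _ _ _ (Subgroup.le_topologicalClosure _ (Subgroup.mem_zpowers x))
  -- `g x g⁻¹ x'⁻¹ = (g x g⁻¹ x⁻¹)(x x'⁻¹) ∈ S' ∩ Π_𝔾 = 1`
  have hq : g * x * g⁻¹ * x'⁻¹ ∈ M.PiG := by
    have : g * x * g⁻¹ * x'⁻¹ = (g * x * g⁻¹ * x⁻¹) * (x * x'⁻¹) := by group
    rw [this]; exact M.PiG.mul_mem (M.commutator_mem_PiG g x) hxx'
  have heq : g * x * g⁻¹ = x' := by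
    rw [← mul_inv_eq_one, ← Subgroup.mem_bot, ← hS']
    exact ⟨S'.mul_mem hgx (S'.inv_mem hx'), hq⟩
  have hcomm : χ g * χ x = χ x * χ g := Subtype.ext (M.isFreeProSigmaCyclic_T.subgroup_comm _ (χ g).2 _ (χ x).2)
  apply hχ
  rw [← heq, map_mul, map_mul, map_inv, hcomm, mul_inv_cancel_right]

/-! ### The node sections are no conjugates of the inertia sections -/

/-- `(w^m)⁻¹ t₀^i · (t₀^i)⁻¹ = (w^m)⁻¹ ∈ Π_𝔾`. [cite: MochizukiAbsTopII2013, Prop 1.3 (x) p.12] -/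
theorem nodeGenIdx_mul_t0_pow_inv_mem (m : ℕ) :
    M.nodeGenIdx i m * (M.ι (SemidirectProduct.inr (Multiplicative.ofAdd (1 : ℤ))) ^ i)⁻¹ ∈ M.PiG := by
  rw [nodeGenIdx, mul_inv_cancel_right]; exact M.PiG.inv_mem (M.w_pow_mem_PiG m)

/-- `(w^m)⁻¹ t₀^i · (u₀^i)⁻¹ = (w^m)⁻¹ w^i ∈ Π_𝔾`. [cite: MochizukiAbsTopII2013, Prop 1.3 (x) p.12] -/
theorem nodeGenIdx_mul_u0_pow_inv_mem (m : ℕ) :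
    M.nodeGenIdx i m * (M.ι (SemidirectProduct.inl (c 1 * c 2 : PuncturedSurfaceGroup 0 4)⁻¹ *
      SemidirectProduct.inr (Multiplicative.ofAdd (1 : ℤ))) ^ i)⁻¹ ∈ M.PiG := by
  rw [nodeGenIdx, u0_pow_eq, mul_inv_rev, inv_inv, mul_assoc, mul_inv_cancel_left]
  exact M.PiG.mul_mem (M.PiG.inv_mem (M.w_pow_mem_PiG m)) (M.w_pow_mem_PiG i)

/-- ★ **The node section `closure ⟨w^{-m} t₀^i⟩` (`m ≥ 1`) is no `P`-conjugate of `I_{v_A} = closure ⟨t₀^i⟩`**: the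
`T`-side character `χ` (`χ(w) = t₀`, `χ|_T = id`) takes the values `t₀^{-m} t₀^{i}` and `t₀^{i}` on the two generators,
which differ since `t₀^m ≠ 1`. [cite: MochizukiAbsTopII2013, Prop 1.3 (x) p.12] -/
theorem not_conj_nodeSection_eq_Tpow (hne : Sigma.Nonempty) (hprime : ∀ p ∈ Sigma, p.Prime) {m : ℕ} (hm : 0 < m)
    (g : M.P) : MulAut.conj g • M.nodeSection i m ≠ M.Tpow i := by
  obtain ⟨χ, -, hχ1, hχ2, -, hχT, -⟩ := M.exists_character_Tside
  refine M.conj_smul_ne_of_character χ (M.t0_pow_mem_Tpow i) (M.Tpow_inf_PiG i) (M.nodeGenIdx_mul_t0_pow_inv_mem i m) ?_ g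
  have hχw : χ (M.ι (SemidirectProduct.inl (c 1 * c 2 : PuncturedSurfaceGroup 0 4))) =
      ⟨M.ι (SemidirectProduct.inr (Multiplicative.ofAdd (1 : ℤ))), M.t0_mem_T⟩ := by
    rw [map_mul SemidirectProduct.inl, map_mul, map_mul, hχ1, hχ2, mul_one]
  intro h
  rw [nodeGenIdx, map_mul, map_inv, map_pow, hχw, mul_eq_right, inv_eq_one] at h
  exact M.t0_pow_ne_one hne hprime hm (by simpa using congrArg Subtype.val h)

/-- ★ **The node section `closure ⟨w^{-m} t₀^i⟩` (`m < i`) is no `P`-conjugate of `I_{v_B} = closure ⟨u₀^i⟩`**: `χ` is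
trivial on `U ∋ u₀^i` but `χ(w^{-m} t₀^i) = t₀^{i-m} ≠ 1`. [cite: MochizukiAbsTopII2013, Prop 1.3 (x) p.12] -/
theorem not_conj_nodeSection_eq_Upow (hne : Sigma.Nonempty) (hprime : ∀ p ∈ Sigma, p.Prime) {m : ℕ} (hmi : m < i)
    (g : M.P) : MulAut.conj g • M.nodeSection i m ≠ M.Upow i := by
  obtain ⟨χ, -, hχ1, hχ2, -, hχT, hχU⟩ := M.exists_character_Tside
  refine M.conj_smul_ne_of_character χ (M.u0_pow_mem_Upow i) (M.Upow_inf_PiG i hne hprime)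
    (M.nodeGenIdx_mul_u0_pow_inv_mem i m) ?_ g
  have hχw : χ (M.ι (SemidirectProduct.inl (c 1 * c 2 : PuncturedSurfaceGroup 0 4))) =
      ⟨M.ι (SemidirectProduct.inr (Multiplicative.ofAdd (1 : ℤ))), M.t0_mem_T⟩ := by
    rw [map_mul SemidirectProduct.inl, map_mul, map_mul, hχ1, hχ2, mul_one]
  have hχt : χ (M.ι (SemidirectProduct.inr (Multiplicative.ofAdd (1 : ℤ)))) =
      ⟨M.ι (SemidirectProduct.inr (Multiplicative.ofAdd (1 : ℤ))), M.t0_mem_T⟩ := hχT _ M.t0_mem_T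
  rw [hχU _ (M.U.pow_mem M.u0_mem_U i), nodeGenIdx, map_mul, map_inv, map_pow, map_pow, hχw, hχt, ne_eq,
    inv_mul_eq_one]
  intro h
  have h' := congrArg Subtype.val h
  simp only [SubmonoidClass.coe_pow] at h'
  -- `t₀^m = t₀^i` with `m < i` gives `t₀^(i-m) = 1`
  have : M.ι (SemidirectProduct.inr (Multiplicative.ofAdd (1 : ℤ))) ^ (i - m) = 1 := by
    rw [pow_sub _ hmi.le, ← h', mul_inv_cancel]
  exact M.t0_pow_ne_one hne hprime (Nat.sub_pos_of_lt hmi) this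

/-! ### A section inside another section equals it; the node sections are NON-VERTICIAL -/

/-- **Complement rigidity**: if `A ⊆ B` are both supplements/complements of the normal `Π_𝔾` in `Π_I^{(i)}` (`A·Π_𝔾 =
Π_I^{(i)}`, `B ∩ Π_𝔾 = 1`, `B ⊆ Π_I^{(i)}`) then `A = B`. [cite: MochizukiAbsTopII2013, Prop 1.3 (x) p.12] -/
theorem eq_of_le_of_isCompl_PiG {A B : Subgroup M.P} (hAB : A ≤ B) (hA : A ⊔ M.PiG = M.PiIdx i) (hB : B ⊓ M.PiG = ⊥)
    (hBI : B ≤ M.PiIdx i) : A = B := by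
  haveI := M.normal_PiG
  refine le_antisymm hAB fun b hb => ?_
  have hb' : b ∈ ((A ⊔ M.PiG : Subgroup M.P) : Set M.P) := by rw [hA]; exact hBI hb
  rw [Subgroup.mul_normal] at hb'
  obtain ⟨a, ha, n, hn, rfl⟩ := Set.mem_mul.mp hb'
  have hnB : n ∈ B := by
    have := B.mul_mem (B.inv_mem (hAB ha)) hb
    rwa [inv_mul_cancel_left] at this
  have hn1 : n = 1 := by rw [← Subgroup.mem_bot, ← hB]; exact ⟨hnB, hn⟩
  rw [hn1, mul_one]; exact ha

/-- ★ **The node section is NON-VERTICIAL**: for `0 < m < i` no conjugate `δ · closure ⟨w^{-m} t₀^i⟩ · δ⁻¹` is contained in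
a conjugate `g I_v g⁻¹` of an inertia section of the index-`i` datum (containment would be equality by complement
rigidity). [cite: MochizukiAbsTopII2013, Prop 1.3 (x) p.12] -/
theorem not_conj_nodeSection_le_conj_vertSecIdx (hne : Sigma.Nonempty) (hprime : ∀ p ∈ Sigma, p.Prime) {m : ℕ}
    (hm : 0 < m) (hmi : m < i) (δ : M.P) (v : Fin 2) (g : M.P) :
    ¬ MulAut.conj δ • M.nodeSection i m ≤ MulAut.conj g • M.vertSecIdx i v := by
  intro h
  have hVI : M.vertSecIdx i v ≤ M.PiIdx i := by rw [← M.vertSecIdx_sup_PiG i v]; exact le_sup_left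
  have h2 : MulAut.conj δ • M.nodeSection i m = MulAut.conj g • M.vertSecIdx i v :=
    M.eq_of_le_of_isCompl_PiG i h (M.conj_smul_sup_PiG_eq_PiIdx i (M.nodeSection_sup_PiG i m) δ)
      (M.conj_smul_inf_PiG_eq_bot (M.vertSecIdx_inf_PiG i hne hprime v) g) (M.conj_smul_le_PiIdx i hVI g)
  have h3 : MulAut.conj (g⁻¹ * δ) • M.nodeSection i m = M.vertSecIdx i v := by
    rw [map_mul, mul_smul, h2, map_inv, inv_smul_smul]
  fin_cases v
  · exact M.not_conj_nodeSection_eq_Tpow i hne hprime hm _ h3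
  · exact M.not_conj_nodeSection_eq_Upow i hne hprime hmi _ h3

/-- **`I_{v_A}` and `I_{v_B}` of the index-`i` datum are not conjugate in `P`** (`T ∩ gUg⁻¹ = 1`, abc-iut-f-066 gen 5;
`closure ⟨t₀^i⟩ ≠ 1`). [cite: MochizukiAbsTopII2013, Prop 1.3 (iv) p.11] -/
theorem conj_vertSecIdx_ne (hne : Sigma.Nonempty) (hprime : ∀ p ∈ Sigma, p.Prime) (hi0 : 0 < i) (v : Fin 2) (δ : M.P)
    {w : Fin 2} (hvw : v ≠ w) (g : M.P) : MulAut.conj δ • M.vertSecIdx i v ≠ MulAut.conj g • M.vertSecIdx i w := by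
  intro h
  have h1 : M.vertSecIdx i v = MulAut.conj (δ⁻¹ * g) • M.vertSecIdx i w := by
    rw [map_mul, mul_smul, map_inv, eq_inv_smul_iff]; exact h
  have hT := M.Tpow_ne_bot i hne hprime hi0
  have key : ∀ x : M.P, M.Tpow i ⊓ MulAut.conj x • M.Upow i = ⊥ := fun x => by
    rw [eq_bot_iff, ← (M.T_inf_conj_U x).1]
    exact inf_le_inf (M.Tpow_le_T i) (Subgroup.pointwise_smul_le_pointwise_smul_iff.mpr (M.Upow_le_U i))
  have hv : v = 0 ∨ v = 1 := by fin_cases v <;> simp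
  have hw : w = 0 ∨ w = 1 := by fin_cases w <;> simp
  rcases hv with rfl | rfl <;> rcases hw with rfl | rfl
  · exact hvw rfl
  · have h2 : M.Tpow i = MulAut.conj (δ⁻¹ * g) • M.Upow i := h1
    apply hT
    rw [← key (δ⁻¹ * g), ← h2, inf_idem]
  · have h2 : M.Tpow i = MulAut.conj (δ⁻¹ * g)⁻¹ • M.Upow i := by
      have h1' : M.Upow i = MulAut.conj (δ⁻¹ * g) • M.Tpow i := h1
      rw [h1', ← mul_smul, ← map_mul, inv_mul_cancel, map_one, one_smul]
    apply hT
    rw [← key (δ⁻¹ * g)⁻¹, ← h2, inf_idem]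
  · exact hvw rfl

/-- A subgroup centralised by `s` is fixed by conjugation by `s`. [cite: MochizukiAbsTopII2013, Prop 1.3 (x) p.12] -/
theorem conj_smul_eq_self_of_forall_comm {S : Subgroup M.P} {s : M.P} (h : ∀ x ∈ S, s * x = x * s) :
    MulAut.conj s • S = S := by
  ext x
  rw [Subgroup.mem_smul_pointwise_iff_exists]
  constructor
  · rintro ⟨y, hy, rfl⟩
    rw [MulAut.smul_def, MulAut.conj_apply, h y hy, mul_inv_cancel_right]; exact hy
  · intro hx
    exact ⟨x, hx, by rw [MulAut.smul_def, MulAut.conj_apply, h x hx, mul_inv_cancel_right]⟩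

/-- **The smooth member's section is a `Π_𝔾`-conjugate of `I_v`** (`δ = γ s`, `s ∈ vertSec v` centralises the abelian
`vertSec v ⊇ I_v(dpscIdx)`). [cite: MochizukiAbsTopII2013, Prop 1.3 (x) p.12] -/
theorem exists_conj_vertSecIdx_eq (hne : Sigma.Nonempty) (hprime : ∀ p ∈ Sigma, p.Prime) (v : Fin 2) (δ : M.P) :
    ∃ γ ∈ M.PiG, MulAut.conj δ • M.vertSecIdx i v = MulAut.conj γ • M.vertSecIdx i v := by
  have hcomm : ∀ a ∈ M.vertSec v, ∀ b ∈ M.vertSec v, a * b = b * a := by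
    fin_cases v
    · exact M.isFreeProSigmaCyclic_T.subgroup_comm
    · exact (M.isFreeProSigmaCyclic_U hne hprime).subgroup_comm
  obtain ⟨γ, hγ, s, hs, rfl⟩ := M.exists_eq_mul_of_sup_eq_top (M.vertSec_sup_PiG v) δ
  refine ⟨γ, hγ, ?_⟩
  rw [map_mul, mul_smul,
    M.conj_smul_eq_self_of_forall_comm fun x hx => hcomm s hs x (M.vertSecIdx_le_vertSec i v hx)]

end Literature.AnabelianGeometry.AbsoluteAnabelian.AbsTopII.TwoTripodNodal.Model

end
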